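import Summits.BirchSwinnertonDyer.BirchSwinnertonDyer.Theorems.AlignedTransportAtTwoMainConjectureTransportAlignedAtTwoKilfordCopyCrossLevelFactorHeckeConductor
import HarnessLib

/-!
# Crux C1 `MainConjectureTransportAlignedAtTwo` (stmt-BirchSwinnertonDyer-22296), line `birth`, residual (R2) `stub_lamLawKilford`, UNEQUAL conductors —
# THE CANONICAL EIGEN-IDEAL AT `lcm(N₁, N₂)` HAS A TWO-ELEMENT QUOTIENT and carries BOTH curves' mod-2 eigencharacters: the `𝔪`-socket of -ty's
# level-`L` carrier `F1Sign2.KernelLetterCarrierAtLevelAtTwo` (p703757: `Nat.card (𝕋 ⧸ 𝔪) = 2`, `T_p − a_p(W) ∈ 𝔪` for `p ∤ L`) (width seat att-p3 g19; `--supports 22296`)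

THEOREMS ONLY (no `def`, no `sorry`, no named fact). -ty g15's «prover's step» (INBOX 2026-08-29 06:45Z): show that the generator ideal
`𝔪 = (2, T_p − a_p(W₁) (p prime ∤ N₁N₂), T_ℓ − β_ℓ (ℓ ∈ S))` of `…CrossLevelFactorHeckeConductor` has a two-element quotient (every `T_p` is an integer
modulo it and `𝕋_ℤ(L) = ℤ[T_p : p prime]`, DDT Lemma 4.1 (a)), is proper as soon as one of the two old-line maps is non-zero on a half-class, and contains
`T_p − a_p(Wᵢ)` for BOTH `i` at every `p ∤ L` (shared cubic field). So `𝔪` instantiates the `(W1)_L` clause of `KernelLetterCarrierAtLevelAtTwo L ι J` for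
`W₁` AND for `W₂`, and `U := J₀(L)[𝔪]` is the common socket of att-p4 g17's consumer `…CrossLevelCommonLevelLetter`. BSD is not proved by this; C1 is not closed
by this; the multiplicity input `finrank_{𝕋/𝔪} J₀(L)[𝔪] = 4` at the (possibly non-squarefree) level `L` is NOT touched (conjecture-grade; census ask to att-p5).

* §1 `adjoin_T_eq_top` (`𝕋_ℤ(L)` is generated by the `T_p` as a ring — transport of `heckeRing0_eq_adjoin`), **`natCard_quotient_eq_two`** (an ideal containing
  `2` and an integer translate of every `T_p` is either `⊤` or of index `2`).
* §2 **`canonicalIdeal_spec`** — for the canonical `𝔪` of a pair on the stratum: `2 ∈ 𝔪`; `T_p − a_p(W₁), T_p − a_p(W₂) ∈ 𝔪` for every prime `p ∤ L`;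
  `𝔪 ≠ ⊤ → Nat.card (𝕋 ⧸ 𝔪) = 2`. `canonicalIdeal_ne_top_of_half_not_mem` — `𝔪 ≠ ⊤` as soon as some half-period of `F₁` (or `F₂`) is NOT integral
  (the non-vanishing input (r5) of the kernel letter, Ihara / `μ = 0` in att-p4 g18's capstones).

References: Darmon–Diamond–Taylor 1995 §4.1 Lemma 4.1 (a), §1.3 [DarmonDiamondTaylor1995]; Diamond–Shurman 2005 Prop. 5.2.4 [DiamondShurman2005]; Cremona 1997
§2.10 [CremonaAlgorithms1997].
-/

noncomputable section

-- justification: the `Summit.BirchSwinnertonDyer.BirchSwinnertonDyer.…` path repeats a component (route-file convention)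
set_option linter.dupNamespace false
set_option autoImplicit false

open scoped MatrixGroups ModularForm Classical

open CongruenceSubgroup Complex WeierstrassCurve IsDedekindDomain Polynomial
open Literature.NumberTheory.EllipticCurves Literature.NumberTheory.EllipticCurves.ModularForms
open Literature.NumberTheory.EllipticCurves.Greenberg1999
open Summit.BirchSwinnertonDyer.Rank1Residual.F1Sign2
open Summit.BirchSwinnertonDyer.BirchSwinnertonDyer.Theorems.AlignedTransportAtTwoKilfordCopyLevelRaisingParity (ne_two_of_dvd_conductorNorm_of_isOrdinaryAt)
open Summit.BirchSwinnertonDyer.BirchSwinnertonDyer.Theorems.AlignedTransportAtTwoSharedCubicTorsion (even_LFunction_sub_of_sharedCubicField)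
open Summit.BirchSwinnertonDyer.BirchSwinnertonDyer.Theorems.AlignedTransportAtTwoKilfordCopyCrossLevelFactorHeckeConductor (canonicalForms_rows)

namespace Summit.BirchSwinnertonDyer.BirchSwinnertonDyer.Theorems.AlignedTransportAtTwoKilfordCopyCrossLevelFactorHeckeIdeal

/-! ## §1 `𝕋_ℤ(L) = ℤ[T_p]`; ideals with integer translates of every `T_p` and containing `2` have index `≤ 2` -/

/-- **`𝕋_ℤ(L)` is generated by the `T_p` (`p` prime) as a ring** — the defining `Algebra.adjoin` of the tree's `heckeRing0`, transported to the type `HeckeRing0 L 2`.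
[cite: DarmonDiamondTaylor1995, §4.1 Lemma 4.1 (a) (p. 107)] -/
theorem adjoin_T_eq_top (L : ℕ) [NeZero L] :
    Algebra.adjoin ℤ {t : HeckeRing0 L 2 | ∃ (p : ℕ) (hp : p.Prime), t = HeckeRing0.T L 2 p hp} = ⊤ := by
  set v : HeckeRing0 L 2 →ₐ[ℤ] Module.End ℂ (CuspForm (Gamma0 L) 2) := (HeckeRing0.toEnd L 2).toIntAlgHom with hv
  have hvinj : Function.Injective v := HeckeRing0.toEnd_injective L 2
  have himg : v '' {t : HeckeRing0 L 2 | ∃ (p : ℕ) (hp : p.Prime), t = HeckeRing0.T L 2 p hp} = heckeRing0Generators L 2 := by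
    ext T
    constructor
    · rintro ⟨t, ⟨p, hp, rfl⟩, rfl⟩
      exact ⟨p, hp, by rw [hv, RingHom.toIntAlgHom_apply, HeckeRing0.toEnd_T]⟩
    · rintro ⟨p, hp, rfl⟩
      exact ⟨HeckeRing0.T L 2 p hp, ⟨p, hp, rfl⟩, by rw [hv, RingHom.toIntAlgHom_apply, HeckeRing0.toEnd_T]⟩
  refine Algebra.eq_top_iff.mpr fun t ↦ ?_
  have ht : v t ∈ Subalgebra.map v (Algebra.adjoin ℤ {t : HeckeRing0 L 2 | ∃ (p : ℕ) (hp : p.Prime), t = HeckeRing0.T L 2 p hp}) := by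
    rw [AlgHom.map_adjoin, himg]
    exact HeckeRing0.toEnd_mem L 2 t
  obtain ⟨s, hs, hst⟩ := Subalgebra.mem_map.mp ht
  rwa [← hvinj hst]

/-- **An ideal of `𝕋_ℤ(L)` containing `2` and an integer translate `T_p − c_p` of every `T_p` is `⊤` or has exactly two residue classes**: every element of
`𝕋_ℤ = ℤ[T_p]` is an integer modulo it, and `2 ≡ 0`. [cite: DarmonDiamondTaylor1995, §4.1 Lemma 4.1 (a)] -/
theorem natCard_quotient_eq_two {L : ℕ} [NeZero L] (I : Ideal (HeckeRing0 L 2)) (h2 : (2 : HeckeRing0 L 2) ∈ I)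
    (hT : ∀ (p : ℕ) (hp : p.Prime), ∃ c : ℤ, HeckeRing0.T L 2 p hp - (c : HeckeRing0 L 2) ∈ I) (hI : I ≠ ⊤) :
    Nat.card (HeckeRing0 L 2 ⧸ I) = 2 := by
  -- every element is an integer modulo `I`
  have hall : ∀ t : HeckeRing0 L 2, ∃ c : ℤ, t - (c : HeckeRing0 L 2) ∈ I := by
    intro t
    have ht : t ∈ Algebra.adjoin ℤ {t : HeckeRing0 L 2 | ∃ (p : ℕ) (hp : p.Prime), t = HeckeRing0.T L 2 p hp} := by
      rw [adjoin_T_eq_top]; exact Algebra.mem_top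
    induction ht using Algebra.adjoin_induction with
    | mem x hx =>
      obtain ⟨p, hp, rfl⟩ := hx
      exact hT p hp
    | algebraMap r =>
      exact ⟨r, by rw [eq_intCast, sub_self]; exact I.zero_mem⟩
    | add x y _ _ hx hy =>
      obtain ⟨c₁, h₁⟩ := hx
      obtain ⟨c₂, h₂⟩ := hy
      refine ⟨c₁ + c₂, ?_⟩
      have h := I.add_mem h₁ h₂
      rw [show x + y - ((c₁ + c₂ : ℤ) : HeckeRing0 L 2) = (x - c₁) + (y - c₂) by push_cast; ring]
      exact h
    | mul x y _ _ hx hy =>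
      obtain ⟨c₁, h₁⟩ := hx
      obtain ⟨c₂, h₂⟩ := hy
      refine ⟨c₁ * c₂, ?_⟩
      have h := I.add_mem (I.mul_mem_right y h₁) (I.mul_mem_left (c₁ : HeckeRing0 L 2) h₂)
      rw [show x * y - ((c₁ * c₂ : ℤ) : HeckeRing0 L 2) = (x - c₁) * y + (c₁ : HeckeRing0 L 2) * (y - c₂) by push_cast; ring]
      exact h
  -- hence every residue class is `0` or `1`
  have hsurj : Function.Surjective (fun b : Bool ↦ if b then (1 : HeckeRing0 L 2 ⧸ I) else 0) := by
    intro q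
    obtain ⟨t, rfl⟩ := Ideal.Quotient.mk_surjective q
    obtain ⟨c, hc⟩ := hall t
    obtain ⟨k, r, hr, hck⟩ : ∃ k r : ℤ, (r = 0 ∨ r = 1) ∧ c = 2 * k + r :=
      ⟨c / 2, c % 2, by omega, by omega⟩
    have hmk : Ideal.Quotient.mk I t = (r : HeckeRing0 L 2 ⧸ I) := by
      have h1 : Ideal.Quotient.mk I t = Ideal.Quotient.mk I (c : HeckeRing0 L 2) := by
        rw [Ideal.Quotient.eq]; exact hc
      have h2 : Ideal.Quotient.mk I ((2 : HeckeRing0 L 2) * k) = 0 :=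
        Ideal.Quotient.eq_zero_iff_mem.mpr (I.mul_mem_right _ h2)
      rw [h1, hck]
      push_cast
      rw [map_add, map_mul, map_intCast, map_intCast, map_ofNat] at *
      rw [show (2 : HeckeRing0 L 2 ⧸ I) * (k : HeckeRing0 L 2 ⧸ I) = 0 by simpa using h2, zero_add]
    rcases hr with rfl | rfl
    · exact ⟨false, by rw [hmk]; simp⟩
    · exact ⟨true, by rw [hmk]; simp⟩
  haveI : Finite (HeckeRing0 L 2 ⧸ I) := Finite.of_surjective _ hsurj
  haveI : Nontrivial (HeckeRing0 L 2 ⧸ I) := Ideal.Quotient.nontrivial_iff.mpr hI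
  have hle : Nat.card (HeckeRing0 L 2 ⧸ I) ≤ 2 := by
    have h := Nat.card_le_card_of_surjective _ hsurj
    simpa using h
  have hlt : 1 < Nat.card (HeckeRing0 L 2 ⧸ I) := Finite.one_lt_card_iff_nontrivial.mpr inferInstance
  omega

/-! ## §2 The canonical eigen-ideal of a pair on the stratum -/

/-- **The canonical eigen-ideal `𝔪 = (2, T_p − a_p(W₁) (p prime ∤ N₁N₂), T_ℓ − β_ℓ (ℓ ∈ S))` at `L = lcm(N₁, N₂)`**: it contains `2`; it contains `T_p − a_p(W₁)` AND
`T_p − a_p(W₂)` for every prime `p ∤ L` (at such `p` both curves are good, `a_p(W₁) ≡ a_p(W₂)` by the shared cubic field, and `a_2` is odd for both — ordinary at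
`2`); and if proper it has exactly two residue classes (`natCard_quotient_eq_two`). These are the `𝔪`-hypotheses of the `(W1)_L` clause of
`F1Sign2.KernelLetterCarrierAtLevelAtTwo L ι J` (p703757) for `W₁` and for `W₂`. [cite: DarmonDiamondTaylor1995, §4.1 Lemma 4.1 (a) and Prop. 2.11 (a)]
[cite: DiamondShurman2005, Prop. 5.2.4] -/
theorem canonicalIdeal_spec
    (W₁ W₂ : WeierstrassCurve ℚ) [W₁.IsElliptic] [W₁.IsGloballyMinimal] [W₂.IsElliptic] [W₂.IsGloballyMinimal]
    (hord₁ : IsOrdinaryAt W₁ 2) (hord₂ : IsOrdinaryAt W₂ 2)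
    {F : Type*} [Field F] [NumberField F] (hF : Module.finrank ℚ F = 3)
    (ht₁ : ∀ x : ℚ, ¬ HasRationalTwoTorsionX W₁ x) (ht₂ : ∀ x : ℚ, ¬ HasRationalTwoTorsionX W₂ x)
    {e₁ e₂ : F} (he₁ : aeval e₁ (twoDivisionUCubic W₁) = 0) (he₂ : aeval e₂ (twoDivisionUCubic W₂) = 0)
    [NeZero (W₁.conductorNorm ℤ)] [NeZero (W₂.conductorNorm ℤ)]
    (L : ℕ) [NeZero L] (hLdef : L = Nat.lcm (W₁.conductorNorm ℤ) (W₂.conductorNorm ℤ)) :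
    (2 : HeckeRing0 L 2) ∈ Ideal.span ({t : HeckeRing0 L 2 | t = 2 ∨
      (∃ (p : ℕ) (hp : p.Prime), p ∉ (W₁.conductorNorm ℤ * W₂.conductorNorm ℤ).primeFactors.erase 2 ∧ t = HeckeRing0.T L 2 p hp - (W₁.LFunction p : HeckeRing0 L 2)) ∨
      (∃ (ℓ : ℕ) (hℓ : ℓ ∈ (W₁.conductorNorm ℤ * W₂.conductorNorm ℤ).primeFactors.erase 2),
        t = HeckeRing0.T L 2 ℓ (Nat.prime_of_mem_primeFactors (Finset.mem_of_mem_erase hℓ)) -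
          ((if (¬ ℓ ^ 2 ∣ W₁.conductorNorm ℤ ∧ ¬ ℓ ^ 2 ∣ W₂.conductorNorm ℤ) then (1 : ℤ) else 0 : ℤ) : HeckeRing0 L 2))}) ∧
    (∀ (p : ℕ) (hp : p.Prime), ¬ p ∣ L →
      (haveI : Fact p.Prime := ⟨hp⟩; HeckeRing0.T L 2 p hp - ((W₁.frobeniusTrace p : ℤ) : HeckeRing0 L 2) ∈ Ideal.span ({t : HeckeRing0 L 2 | t = 2 ∨
      (∃ (p : ℕ) (hp : p.Prime), p ∉ (W₁.conductorNorm ℤ * W₂.conductorNorm ℤ).primeFactors.erase 2 ∧ t = HeckeRing0.T L 2 p hp - (W₁.LFunction p : HeckeRing0 L 2)) ∨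
      (∃ (ℓ : ℕ) (hℓ : ℓ ∈ (W₁.conductorNorm ℤ * W₂.conductorNorm ℤ).primeFactors.erase 2),
        t = HeckeRing0.T L 2 ℓ (Nat.prime_of_mem_primeFactors (Finset.mem_of_mem_erase hℓ)) -
          ((if (¬ ℓ ^ 2 ∣ W₁.conductorNorm ℤ ∧ ¬ ℓ ^ 2 ∣ W₂.conductorNorm ℤ) then (1 : ℤ) else 0 : ℤ) : HeckeRing0 L 2))}) ∧
        HeckeRing0.T L 2 p hp - ((W₂.frobeniusTrace p : ℤ) : HeckeRing0 L 2) ∈ Ideal.span ({t : HeckeRing0 L 2 | t = 2 ∨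
      (∃ (p : ℕ) (hp : p.Prime), p ∉ (W₁.conductorNorm ℤ * W₂.conductorNorm ℤ).primeFactors.erase 2 ∧ t = HeckeRing0.T L 2 p hp - (W₁.LFunction p : HeckeRing0 L 2)) ∨
      (∃ (ℓ : ℕ) (hℓ : ℓ ∈ (W₁.conductorNorm ℤ * W₂.conductorNorm ℤ).primeFactors.erase 2),
        t = HeckeRing0.T L 2 ℓ (Nat.prime_of_mem_primeFactors (Finset.mem_of_mem_erase hℓ)) -
          ((if (¬ ℓ ^ 2 ∣ W₁.conductorNorm ℤ ∧ ¬ ℓ ^ 2 ∣ W₂.conductorNorm ℤ) then (1 : ℤ) else 0 : ℤ) : HeckeRing0 L 2))}))) ∧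
    (Ideal.span ({t : HeckeRing0 L 2 | t = 2 ∨
      (∃ (p : ℕ) (hp : p.Prime), p ∉ (W₁.conductorNorm ℤ * W₂.conductorNorm ℤ).primeFactors.erase 2 ∧ t = HeckeRing0.T L 2 p hp - (W₁.LFunction p : HeckeRing0 L 2)) ∨
      (∃ (ℓ : ℕ) (hℓ : ℓ ∈ (W₁.conductorNorm ℤ * W₂.conductorNorm ℤ).primeFactors.erase 2),
        t = HeckeRing0.T L 2 ℓ (Nat.prime_of_mem_primeFactors (Finset.mem_of_mem_erase hℓ)) -
          ((if (¬ ℓ ^ 2 ∣ W₁.conductorNorm ℤ ∧ ¬ ℓ ^ 2 ∣ W₂.conductorNorm ℤ) then (1 : ℤ) else 0 : ℤ) : HeckeRing0 L 2))}) ≠ ⊤ → Nat.card (HeckeRing0 L 2 ⧸ Ideal.span ({t : HeckeRing0 L 2 | t = 2 ∨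
      (∃ (p : ℕ) (hp : p.Prime), p ∉ (W₁.conductorNorm ℤ * W₂.conductorNorm ℤ).primeFactors.erase 2 ∧ t = HeckeRing0.T L 2 p hp - (W₁.LFunction p : HeckeRing0 L 2)) ∨
      (∃ (ℓ : ℕ) (hℓ : ℓ ∈ (W₁.conductorNorm ℤ * W₂.conductorNorm ℤ).primeFactors.erase 2),
        t = HeckeRing0.T L 2 ℓ (Nat.prime_of_mem_primeFactors (Finset.mem_of_mem_erase hℓ)) -
          ((if (¬ ℓ ^ 2 ∣ W₁.conductorNorm ℤ ∧ ¬ ℓ ^ 2 ∣ W₂.conductorNorm ℤ) then (1 : ℤ) else 0 : ℤ) : HeckeRing0 L 2))})) = 2) := by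
  classical
  set S : Finset ℕ := (W₁.conductorNorm ℤ * W₂.conductorNorm ℤ).primeFactors.erase 2 with hSdef
  have hN₁ : W₁.conductorNorm ℤ ≠ 0 := NeZero.ne _
  have hN₂ : W₂.conductorNorm ℤ ≠ 0 := NeZero.ne _
  have hS : ∀ ℓ ∈ S, ℓ.Prime := fun ℓ hℓ ↦ Nat.prime_of_mem_primeFactors (Finset.mem_of_mem_erase hℓ)
  have hLS : ∀ p : ℕ, p.Prime → p ∣ L → p ∈ S := by
    intro p hp hpL
    have hpNN : p ∣ W₁.conductorNorm ℤ * W₂.conductorNorm ℤ := by rw [hLdef] at hpL; exact hpL.trans (Nat.lcm_dvd_mul _ _)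
    refine Finset.mem_erase.mpr ⟨?_, Nat.mem_primeFactors.mpr ⟨hp, hpNN, mul_ne_zero hN₁ hN₂⟩⟩
    rcases (Nat.Prime.dvd_mul hp).mp hpNN with h | h
    · exact ne_two_of_dvd_conductorNorm_of_isOrdinaryAt W₁ hord₁ h
    · exact ne_two_of_dvd_conductorNorm_of_isOrdinaryAt W₂ hord₂ h
  have hSL : ∀ p : ℕ, p.Prime → p ∈ S → p ∣ L := by
    intro p hp hpS
    have hpNN : p ∣ W₁.conductorNorm ℤ * W₂.conductorNorm ℤ := Nat.dvd_of_mem_primeFactors (Finset.mem_of_mem_erase hpS)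
    rw [hLdef]
    rcases (Nat.Prime.dvd_mul hp).mp hpNN with h | h
    · exact h.trans (Nat.dvd_lcm_left _ _)
    · exact h.trans (Nat.dvd_lcm_right _ _)
  have h2 : (2 : HeckeRing0 L 2) ∈ Ideal.span ({t : HeckeRing0 L 2 | t = 2 ∨
      (∃ (p : ℕ) (hp : p.Prime), p ∉ (W₁.conductorNorm ℤ * W₂.conductorNorm ℤ).primeFactors.erase 2 ∧ t = HeckeRing0.T L 2 p hp - (W₁.LFunction p : HeckeRing0 L 2)) ∨
      (∃ (ℓ : ℕ) (hℓ : ℓ ∈ (W₁.conductorNorm ℤ * W₂.conductorNorm ℤ).primeFactors.erase 2),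
        t = HeckeRing0.T L 2 ℓ (Nat.prime_of_mem_primeFactors (Finset.mem_of_mem_erase hℓ)) -
          ((if (¬ ℓ ^ 2 ∣ W₁.conductorNorm ℤ ∧ ¬ ℓ ^ 2 ∣ W₂.conductorNorm ℤ) then (1 : ℤ) else 0 : ℤ) : HeckeRing0 L 2))}) := Ideal.subset_span (Or.inl rfl)
  refine ⟨h2, fun p hp hpL ↦ ?_, fun hI ↦ ?_⟩
  · -- `p ∤ L`: both curves good at `p`, `p ∉ S`
    haveI : Fact p.Prime := ⟨hp⟩
    have hpS : p ∉ S := fun h ↦ hpL (hSL p hp h)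
    have hp₁ : ¬ p ∣ W₁.conductorNorm ℤ := fun h ↦ hpL (by rw [hLdef]; exact h.trans (Nat.dvd_lcm_left _ _))
    have hp₂ : ¬ p ∣ W₂.conductorNorm ℤ := fun h ↦ hpL (by rw [hLdef]; exact h.trans (Nat.dvd_lcm_right _ _))
    have hg₁ : W₁.HasGoodReductionAtPrime p := hasGoodReductionAtPrime_of_not_dvd_conductorNorm W₁ hp₁
    have hg₂ : W₂.HasGoodReductionAtPrime p := hasGoodReductionAtPrime_of_not_dvd_conductorNorm W₂ hp₂
    have hgen : HeckeRing0.T L 2 p hp - (W₁.LFunction p : HeckeRing0 L 2) ∈ Ideal.span ({t : HeckeRing0 L 2 | t = 2 ∨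
      (∃ (p : ℕ) (hp : p.Prime), p ∉ (W₁.conductorNorm ℤ * W₂.conductorNorm ℤ).primeFactors.erase 2 ∧ t = HeckeRing0.T L 2 p hp - (W₁.LFunction p : HeckeRing0 L 2)) ∨
      (∃ (ℓ : ℕ) (hℓ : ℓ ∈ (W₁.conductorNorm ℤ * W₂.conductorNorm ℤ).primeFactors.erase 2),
        t = HeckeRing0.T L 2 ℓ (Nat.prime_of_mem_primeFactors (Finset.mem_of_mem_erase hℓ)) -
          ((if (¬ ℓ ^ 2 ∣ W₁.conductorNorm ℤ ∧ ¬ ℓ ^ 2 ∣ W₂.conductorNorm ℤ) then (1 : ℤ) else 0 : ℤ) : HeckeRing0 L 2))}) :=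
      Ideal.subset_span (Or.inr (Or.inl ⟨p, hp, hpS, rfl⟩))
    have hcongr : (2 : ℤ) ∣ W₁.LFunction p - W₂.LFunction p := by
      by_cases hp2 : p = 2
      · subst hp2
        rw [LFunction_apply_prime_eq_frobeniusTrace W₁ 2 hord₁.1, LFunction_apply_prime_eq_frobeniusTrace W₂ 2 hord₂.1]
        have h₁ := hord₁.2
        have h₂ := hord₂.2
        push_cast at h₁ h₂
        omega
      · exact (even_LFunction_sub_of_sharedCubicField W₁ W₂ hF ht₁ ht₂ he₁ he₂ hp hp2 hp₁ hp₂).two_dvd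
    obtain ⟨k, hk⟩ := hcongr
    refine ⟨by rw [← LFunction_apply_prime_eq_frobeniusTrace W₁ p hg₁]; exact hgen, ?_⟩
    have e : HeckeRing0.T L 2 p hp - ((W₂.frobeniusTrace p : ℤ) : HeckeRing0 L 2) =
        (HeckeRing0.T L 2 p hp - (W₁.LFunction p : HeckeRing0 L 2)) + (k : HeckeRing0 L 2) * 2 := by
      rw [← LFunction_apply_prime_eq_frobeniusTrace W₂ p hg₂]
      have hk' : ((W₁.LFunction p : ℤ) : HeckeRing0 L 2) - (W₂.LFunction p : HeckeRing0 L 2) = (k : HeckeRing0 L 2) * 2 := by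
        rw [← Int.cast_sub, hk]; push_cast; ring
      linear_combination hk'
    rw [e]
    exact Ideal.add_mem _ hgen (Ideal.mul_mem_left _ _ h2)
  · refine natCard_quotient_eq_two _ h2 (fun p hp ↦ ?_) hI
    by_cases hpS : p ∈ S
    · exact ⟨_, Ideal.subset_span (Or.inr (Or.inr ⟨p, hpS, rfl⟩))⟩
    · exact ⟨W₁.LFunction p, Ideal.subset_span (Or.inr (Or.inl ⟨p, hp, hpS, rfl⟩))⟩

/-- **The canonical eigen-ideal is PROPER as soon as some half-period of one canonical form is not integral** (the non-vanishing row of the kernel letter: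
«`θ_{F₁}[y/2] ≠ O` for some cycle `y`», supplied in att-p4 g18's capstones by Ihara / a `μ = 0` lift): by `canonicalForms_rows` the ideal kills every
half-period, so `1 ∉ 𝔪`. [cite: DarmonDiamondTaylor1995, §1.3 and §4.1] [cite: CremonaAlgorithms1997, §2.10] -/
theorem canonicalIdeal_ne_top_of_half_not_mem
    (W₁ W₂ : WeierstrassCurve ℚ) [W₁.IsElliptic] [W₁.IsGloballyMinimal] [W₂.IsElliptic] [W₂.IsGloballyMinimal]
    (hord₁ : IsOrdinaryAt W₁ 2) (hord₂ : IsOrdinaryAt W₂ 2)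
    {F : Type*} [Field F] [NumberField F] (hF : Module.finrank ℚ F = 3)
    (ht₁ : ∀ x : ℚ, ¬ HasRationalTwoTorsionX W₁ x) (ht₂ : ∀ x : ℚ, ¬ HasRationalTwoTorsionX W₂ x)
    {e₁ e₂ : F} (he₁ : aeval e₁ (twoDivisionUCubic W₁) = 0) (he₂ : aeval e₂ (twoDivisionUCubic W₂) = 0)
    [NeZero (W₁.conductorNorm ℤ)] [NeZero (W₂.conductorNorm ℤ)]
    (D₁ : ModularParametrizationData W₁ (W₁.conductorNorm ℤ)) (D₂ : ModularParametrizationData W₂ (W₂.conductorNorm ℤ))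
    (L : ℕ) [NeZero L] (hLdef : L = Nat.lcm (W₁.conductorNorm ℤ) (W₂.conductorNorm ℤ))
    (F₁ F₂ : CuspForm (Gamma0 L) 2)
    (hF₁ : ∀ n : ℕ, cuspCoeff F₁ n =
          ((∏ ℓ ∈ (W₁.conductorNorm ℤ * W₂.conductorNorm ℤ).primeFactors.erase 2,
            (MonoidAlgebra.single 1 (1 : ℂ) + MonoidAlgebra.single ℓ ((if ((¬ ℓ ∣ W₁.conductorNorm ℤ ∧ ℓ ∣ W₂.conductorNorm ℤ ∧ (¬ ℓ ^ 2 ∣ W₂.conductorNorm ℤ ∨ Odd (W₁.LFunction ℓ))) ∨ (ℓ ∣ W₁.conductorNorm ℤ ∧ ¬ ℓ ^ 2 ∣ W₁.conductorNorm ℤ ∧ ℓ ^ 2 ∣ W₂.conductorNorm ℤ)) then (1 : ℤ) else 0 : ℤ) : ℂ) +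
              MonoidAlgebra.single (ℓ ^ 2) ((if (¬ ℓ ∣ W₁.conductorNorm ℤ ∧ ℓ ^ 2 ∣ W₂.conductorNorm ℤ) then (1 : ℤ) else 0 : ℤ) : ℂ)) : MonoidAlgebra ℂ ℕ).coeff.sum
            fun m c ↦ c * ((m : ℂ) * if m ∣ n then cuspCoeff D₁.f (n / m) else 0)))
    (hF₂ : ∀ n : ℕ, cuspCoeff F₂ n =
          ((∏ ℓ ∈ (W₁.conductorNorm ℤ * W₂.conductorNorm ℤ).primeFactors.erase 2,
            (MonoidAlgebra.single 1 (1 : ℂ) + MonoidAlgebra.single ℓ ((if ((¬ ℓ ∣ W₂.conductorNorm ℤ ∧ ℓ ∣ W₁.conductorNorm ℤ ∧ (¬ ℓ ^ 2 ∣ W₁.conductorNorm ℤ ∨ Odd (W₂.LFunction ℓ))) ∨ (ℓ ∣ W₂.conductorNorm ℤ ∧ ¬ ℓ ^ 2 ∣ W₂.conductorNorm ℤ ∧ ℓ ^ 2 ∣ W₁.conductorNorm ℤ)) then (1 : ℤ) else 0 : ℤ) : ℂ) +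
              MonoidAlgebra.single (ℓ ^ 2) ((if (¬ ℓ ∣ W₂.conductorNorm ℤ ∧ ℓ ^ 2 ∣ W₁.conductorNorm ℤ) then (1 : ℤ) else 0 : ℤ) : ℂ)) : MonoidAlgebra ℂ ℕ).coeff.sum
            fun m c ↦ c * ((m : ℂ) * if m ∣ n then cuspCoeff D₂.f (n / m) else 0)))
    (hnz : ∃ y ∈ periodHomology L, (D₁.c : ℂ) * y F₁ / 2 ∉ D₁.L.lattice ∨ (D₂.c : ℂ) * y F₂ / 2 ∉ D₂.L.lattice) :
    Ideal.span ({t : HeckeRing0 L 2 | t = 2 ∨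
      (∃ (p : ℕ) (hp : p.Prime), p ∉ (W₁.conductorNorm ℤ * W₂.conductorNorm ℤ).primeFactors.erase 2 ∧ t = HeckeRing0.T L 2 p hp - (W₁.LFunction p : HeckeRing0 L 2)) ∨
      (∃ (ℓ : ℕ) (hℓ : ℓ ∈ (W₁.conductorNorm ℤ * W₂.conductorNorm ℤ).primeFactors.erase 2),
        t = HeckeRing0.T L 2 ℓ (Nat.prime_of_mem_primeFactors (Finset.mem_of_mem_erase hℓ)) -
          ((if (¬ ℓ ^ 2 ∣ W₁.conductorNorm ℤ ∧ ¬ ℓ ^ 2 ∣ W₂.conductorNorm ℤ) then (1 : ℤ) else 0 : ℤ) : HeckeRing0 L 2))}) ≠ ⊤ := by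
  intro htop
  obtain ⟨y, hy, hne⟩ := hnz
  have h1 : (1 : HeckeRing0 L 2) ∈ Ideal.span ({t : HeckeRing0 L 2 | t = 2 ∨
      (∃ (p : ℕ) (hp : p.Prime), p ∉ (W₁.conductorNorm ℤ * W₂.conductorNorm ℤ).primeFactors.erase 2 ∧ t = HeckeRing0.T L 2 p hp - (W₁.LFunction p : HeckeRing0 L 2)) ∨
      (∃ (ℓ : ℕ) (hℓ : ℓ ∈ (W₁.conductorNorm ℤ * W₂.conductorNorm ℤ).primeFactors.erase 2),
        t = HeckeRing0.T L 2 ℓ (Nat.prime_of_mem_primeFactors (Finset.mem_of_mem_erase hℓ)) -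
          ((if (¬ ℓ ^ 2 ∣ W₁.conductorNorm ℤ ∧ ¬ ℓ ^ 2 ∣ W₂.conductorNorm ℤ) then (1 : ℤ) else 0 : ℤ) : HeckeRing0 L 2))}) := by
    rw [htop]; exact Submodule.mem_top
  obtain ⟨h₁, h₂⟩ := (canonicalForms_rows W₁ W₂ hord₁ hord₂ hF ht₁ ht₂ he₁ he₂ D₁ D₂ L hLdef F₁ F₂ hF₁ hF₂).2.2.2.2 1 h1
    ⟨y, (mem_periodHomologyHecke L).mpr hy⟩
  rw [one_smul] at h₁ h₂
  exact hne.elim (fun h ↦ h h₁) (fun h ↦ h h₂)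

end Summit.BirchSwinnertonDyer.BirchSwinnertonDyer.Theorems.AlignedTransportAtTwoKilfordCopyCrossLevelFactorHeckeIdeal

end
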